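import Summits.NavierStokesRegularity.NavierStokesRegularity.Theses.FilamentSkeletonRss
import Literature.Analysis.FluidPDE.GaussianWeightedSpace
import Literature.Analysis.FluidPDE.GaussianVortexKernelRadial
import Literature.Analysis.FluidPDE.PlanarPolarCoords
import Literature.Analysis.FluidPDE.ArnoldCoercivityGaussianVortex

/-!
# Wave-3 interface stubs (lead scratch file; elaboration check of the registered signatures)

(A) discharge of `GallaySverak2021_thm25_gaussian`: `stub_arnoldModeOne1D`, `stub_arnoldModeSplit`,
`stub_arnoldHighModes`; (B) even-sector building blocks: `stub_evenSymmetrizerBounds`,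
`stub_evenSymmetrizerBoundedBelow`, `stub_radialBlock`.
-/

set_option linter.dupNamespace false

noncomputable section

namespace Summit.NavierStokesRegularity.NavierStokesRegularity.Theorems

open Set Function Filter MeasureTheory Topology
open Literature.Analysis.FluidPDE
open scoped InnerProductSpace Laplacian ContDiff

/-- (A1) The one-dimensional constrained Arnold coercivity in the angular mode `k = ±1` at the Gaussian:
for the radial coefficient `a` (continuous, Gaussian class) with our first-moment constraint `∫ r² a = 0`,
`γ ∫ A a² r ≤ ∫ A a² r − ∫ (B₁a) a r` with `A = 1/Φ = (kerWeight)⁻¹` and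
`(B₁a)(r) = ½ ∫₀^∞ min(r/s, s/r) a(s) s ds` (Gallay–Šverák (Bkdef), k = 1). Hilbert–Schmidt deflation:
the top eigenpair of `B̃₁ = A^{-1/2}B₁A^{-1/2}` on `L²(r dr)` is `(1, k̂ ∝ Φ^{-1/2} rG)`, and
`‖B̃₁ − k̂⊗k̂‖²_{HS} = h − 1 < 1`, `h = ¼∫∫ min(r/s,s/r)² Φ(r)Φ(s) rs dr ds ≈ 1.08`. -/
theorem stub_arnoldModeOne1D :
    ∃ γ : ℝ, 0 < γ ∧ ∀ a : ℝ → ℝ, ContinuousOn a (Set.Ici 0) →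
    (∃ (C : ℝ) (N : ℕ), ∀ r : ℝ, 0 ≤ r → |a r| ≤ C * (1 + r) ^ N * Real.exp (-(r ^ 2 / 4))) →
    ∫ r in Set.Ioi (0 : ℝ), r ^ 2 * a r = 0 →
    γ * ∫ r in Set.Ioi (0 : ℝ), (kerWeight r)⁻¹ * a r ^ 2 * r ≤
      (∫ r in Set.Ioi (0 : ℝ), (kerWeight r)⁻¹ * a r ^ 2 * r) -
        ∫ r in Set.Ioi (0 : ℝ),
          ((1 / 2 : ℝ) * ∫ s in Set.Ioi (0 : ℝ), min (r / s) (s / r) * a s * s) * a r * r := by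
  sorry

/-- (A2) Splitting an odd Gaussian-class density into its `k = ±1` angular part
`ω₁ = (a(|x|) x₀ + b(|x|) x₁)/|x|` and the rest `ω_r`: orthogonality in `L²(Φ⁻¹)`, the per-mode
potential formula `∫ ω ψ_ω = −π ∫ ((B₁a) a + (B₁b) b) r + ∫ ω_r ψ_{ω_r}` (Biot–Savart angular modes),
vanishing `k = ±1` circle coefficients of `ω_r`, and the moment constraints on `a`, `b`. -/
theorem stub_arnoldModeSplit :
    ∀ (om : EuclideanSpace ℝ (Fin 2) → ℝ) (a b : ℝ → ℝ) (om₁ omr : EuclideanSpace ℝ (Fin 2) → ℝ),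
    Continuous om →
    (∃ (C : ℝ) (N : ℕ), ∀ x, |om x| ≤ C * (1 + ‖x‖) ^ N * Real.exp (-(‖x‖ ^ 2 / 4))) →
    (∀ x, om (-x) = -om x) → ∫ x, x 0 * om x = 0 → ∫ x, x 1 * om x = 0 →
    (∀ r, a r = (1 / Real.pi) * ∫ θ in (-Real.pi)..Real.pi, om (circlePt r θ) * Real.cos θ) →
    (∀ r, b r = (1 / Real.pi) * ∫ θ in (-Real.pi)..Real.pi, om (circlePt r θ) * Real.sin θ) →
    (∀ x, om₁ x = (a ‖x‖ * x 0 + b ‖x‖ * x 1) / ‖x‖) →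
    (∀ x, omr x = om x - om₁ x) →
    ContinuousOn a (Set.Ici 0) ∧ ContinuousOn b (Set.Ici 0) ∧
    (∃ (C : ℝ) (N : ℕ), ∀ r : ℝ, 0 ≤ r →
      |a r| ≤ C * (1 + r) ^ N * Real.exp (-(r ^ 2 / 4)) ∧
      |b r| ≤ C * (1 + r) ^ N * Real.exp (-(r ^ 2 / 4))) ∧
    Continuous omr ∧
    (∃ (C : ℝ) (N : ℕ), ∀ x, |omr x| ≤ C * (1 + ‖x‖) ^ N * Real.exp (-(‖x‖ ^ 2 / 4))) ∧
    (∀ x, omr (-x) = -omr x) ∧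
    (∀ r : ℝ, 0 < r →
      ∫ θ in (-Real.pi)..Real.pi, omr (circlePt r θ) * Real.cos θ = 0 ∧
      ∫ θ in (-Real.pi)..Real.pi, omr (circlePt r θ) * Real.sin θ = 0) ∧
    ∫ r in Set.Ioi (0 : ℝ), r ^ 2 * a r = 0 ∧ ∫ r in Set.Ioi (0 : ℝ), r ^ 2 * b r = 0 ∧
    ∫ x, (kerWeight ‖x‖)⁻¹ * om x ^ 2 =
      Real.pi * (∫ r in Set.Ioi (0 : ℝ), (kerWeight r)⁻¹ * (a r ^ 2 + b r ^ 2) * r) +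
        ∫ x, (kerWeight ‖x‖)⁻¹ * omr x ^ 2 ∧
    ∫ x, om x * ∫ y, (2 * Real.pi)⁻¹ * Real.log ‖x - y‖ * om y =
      -(Real.pi * ∫ r in Set.Ioi (0 : ℝ),
          (((1 / 2 : ℝ) * ∫ s in Set.Ioi (0 : ℝ), min (r / s) (s / r) * a s * s) * a r +
            ((1 / 2 : ℝ) * ∫ s in Set.Ioi (0 : ℝ), min (r / s) (s / r) * b s * s) * b r) * r) +
        ∫ x, omr x * ∫ y, (2 * Real.pi)⁻¹ * Real.log ‖x - y‖ * omr y := by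
  sorry

/-- (A3) Arnold's form is explicitly coercive on odd Gaussian-class densities with no `k = ±1` modes
(`Φ|x|² ≤ 2.8`, Hardy–Wirtinger with constant `1/3` for odd functions with vanishing `k = ±1`
coefficients): `∫ ω_r ψ_{ω_r} ≥ −(19/20) ∫ Φ⁻¹ ω_r²`. -/
theorem stub_arnoldHighModes :
    ∀ omr : EuclideanSpace ℝ (Fin 2) → ℝ, Continuous omr →
    (∃ (C : ℝ) (N : ℕ), ∀ x, |omr x| ≤ C * (1 + ‖x‖) ^ N * Real.exp (-(‖x‖ ^ 2 / 4))) →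
    (∀ x, omr (-x) = -omr x) →
    (∀ r : ℝ, 0 < r →
      ∫ θ in (-Real.pi)..Real.pi, omr (circlePt r θ) * Real.cos θ = 0 ∧
      ∫ θ in (-Real.pi)..Real.pi, omr (circlePt r θ) * Real.sin θ = 0) →
    -((19 / 20 : ℝ) * ∫ x, (kerWeight ‖x‖)⁻¹ * omr x ^ 2) ≤
      ∫ x, omr x * ∫ y, (2 * Real.pi)⁻¹ * Real.log ‖x - y‖ * omr y := by
  sorry

/-- (B1) Forward symmetrizer for EVEN circular-mean-free `C²_c` vorticities (the non-radial even part):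
as `stub_oddSymmetrizerBounds`, plus circular-mean-freeness of `u` and the weighted gradient bound. -/
theorem stub_evenSymmetrizerBounds :
    ∀ lam ∈ Set.Ioo (0 : ℝ) 1, ∃ C : ℝ, 0 ≤ C ∧
    ∀ (w ψ u : EuclideanSpace ℝ (Fin 2) → ℝ), ContDiff ℝ 2 w → HasCompactSupport w →
    (∀ x, w (-x) = w x) →
    (∀ r : ℝ, 0 < r → ∫ θ in (-Real.pi)..Real.pi, w (circlePt r θ) = 0) →
    (∀ x, ψ x = ∫ y, (2 * Real.pi)⁻¹ * Real.log ‖x - y‖ * w y) →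
    (∀ x, u x = kerWeight ‖x‖ * ψ x) →
    ContDiff ℝ 2 u ∧ (∀ x, u (-x) = u x) ∧
    (∀ r : ℝ, 0 < r → ∫ θ in (-Real.pi)..Real.pi, u (circlePt r θ) = 0) ∧
    (∃ (C' : ℝ) (N : ℕ), ∀ x : EuclideanSpace ℝ (Fin 2),
      |w x + u x| ≤ C' * (1 + ‖x‖) ^ N * Real.exp (-(‖x‖ ^ 2 / 4)) ∧
      ‖fderiv ℝ (fun y => w y + u y) x‖ ≤ C' * (1 + ‖x‖) ^ N * Real.exp (-(‖x‖ ^ 2 / 4)) ∧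
      ‖fderiv ℝ (fderiv ℝ (fun y => w y + u y)) x‖ ≤ C' * (1 + ‖x‖) ^ N * Real.exp (-(‖x‖ ^ 2 / 4))) ∧
    (∀ (R : ℝ) (x : EuclideanSpace ℝ (Fin 2)),
      strainedVorticityOperator lam w x -
          R * (⟪gaussVortexVelocity x, gradient w x⟫_ℝ +
            ⟪biotSavart2D w x, gradient gaussVortexProfile x⟫_ℝ) =
        (strainedVorticityOperator lam (fun y => w y + u y) x -
            R * ⟪gaussVortexVelocity x, gradient (fun y => w y + u y) x⟫_ℝ) -
          strainedVorticityOperator lam u x) ∧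
    Integrable (fun x => (gaussWeightLam lam x)⁻¹ * w x ^ 2) ∧
    (∀ R : ℝ, Integrable (fun x => (gaussWeightLam lam x)⁻¹ * (strainedVorticityOperator lam w x -
      R * (⟪gaussVortexVelocity x, gradient w x⟫_ℝ +
        ⟪biotSavart2D w x, gradient gaussVortexProfile x⟫_ℝ)) ^ 2)) ∧
    Integrable (fun x => (gaussWeightLam lam x)⁻¹ * (w x + u x) ^ 2) ∧
    Integrable (fun x => (gaussWeightLam lam x)⁻¹ * (strainedVorticityOperator lam u x) ^ 2) ∧
    (∀ R : ℝ, Integrable (fun x => (gaussWeightLam lam x)⁻¹ *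
      (strainedVorticityOperator lam (fun y => w y + u y) x -
        R * ⟪gaussVortexVelocity x, gradient (fun y => w y + u y) x⟫_ℝ) ^ 2)) ∧
    Continuous (fun x => strainedVorticityOperator lam u x) ∧
    (∀ R : ℝ, Continuous (fun x => strainedVorticityOperator lam (fun y => w y + u y) x -
        R * ⟪gaussVortexVelocity x, gradient (fun y => w y + u y) x⟫_ℝ)) ∧
    ∫ x, (gaussWeightLam lam x)⁻¹ * (strainedVorticityOperator lam u x) ^ 2 ≤
      C ^ 2 * ∫ x, (gaussWeightLam lam x)⁻¹ * w x ^ 2 ∧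
    Integrable (fun x => (gaussWeightLam lam x)⁻¹ * (‖x‖ ^ 2 * ‖fderiv ℝ u x‖ ^ 2)) ∧
    ∫ x, (gaussWeightLam lam x)⁻¹ * (‖x‖ ^ 2 * ‖fderiv ℝ u x‖ ^ 2) ≤
      C ^ 2 * ∫ x, (gaussWeightLam lam x)⁻¹ * w x ^ 2 := by
  sorry

/-- (B2) The symmetrizer is bounded below on EVEN circular-mean-free `C²_c` vorticities (explicit
Arnold coercivity for modes `|k| ≥ 2`: `Φ|x|² ≤ 2.8`, Hardy–Wirtinger `¼`; transfer to `X_λ`, `λ > 0`). -/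
theorem stub_evenSymmetrizerBoundedBelow :
    ∀ lam ∈ Set.Ioo (0 : ℝ) 1, ∃ C : ℝ, 0 < C ∧
    ∀ (w ψ u : EuclideanSpace ℝ (Fin 2) → ℝ), ContDiff ℝ 2 w → HasCompactSupport w →
    (∀ x, w (-x) = w x) →
    (∀ r : ℝ, 0 < r → ∫ θ in (-Real.pi)..Real.pi, w (circlePt r θ) = 0) →
    (∀ x, ψ x = ∫ y, (2 * Real.pi)⁻¹ * Real.log ‖x - y‖ * w y) →
    (∀ x, u x = kerWeight ‖x‖ * ψ x) →
    ∫ x, (gaussWeightLam lam x)⁻¹ * w x ^ 2 ≤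
      C ^ 2 * ∫ x, (gaussWeightLam lam x)⁻¹ * (w x + u x) ^ 2 := by
  sorry

/-- (B3) The radial block: `L = Δ + ½x·∇ + 1` (`strainedVorticityOperator 0`) is bounded below, with
graph control of `|x| w` and `|x| ∇w`, on RADIAL mass-zero `C²_c` vorticities in `X_λ`, every `λ ∈ [0,1)`
(explicit inverse of the radial ODE `(rG h')' = r f`, `w = G h`, weighted Hardy; `(E)`/`(W)` identities). -/
theorem stub_radialBlock :
    ∀ lam ∈ Set.Ico (0 : ℝ) 1, ∃ C : ℝ, 0 ≤ C ∧
    ∀ w : EuclideanSpace ℝ (Fin 2) → ℝ, ContDiff ℝ 2 w → HasCompactSupport w →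
    (∀ x y : EuclideanSpace ℝ (Fin 2), ‖x‖ = ‖y‖ → w x = w y) → ∫ x, w x = 0 →
    ∫ x, (gaussWeightLam lam x)⁻¹ * ((1 + ‖x‖ ^ 2) * w x ^ 2 + ‖x‖ ^ 2 * ‖fderiv ℝ w x‖ ^ 2) ≤
      C ^ 2 * ∫ x, (gaussWeightLam lam x)⁻¹ * (strainedVorticityOperator 0 w x) ^ 2 := by
  sorry

end Summit.NavierStokesRegularity.NavierStokesRegularity.Theorems
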